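import Summits.RiemannHypothesis.RiemannHypothesis.Theorems.IntegerScrewRung512
import Summits.RiemannHypothesis.RiemannHypothesis.Theorems.IntegerScrewRung256
import Summits.RiemannHypothesis.RiemannHypothesis.Theorems.IntegerScrewRung128
import Summits.RiemannHypothesis.RiemannHypothesis.Theorems.PlantedPair

/-!
# W-06 cycle 7 «DETECTION COST ATLAS», cell C4⁷ — KERNEL PILOT (rh-idea-6 g15): the SCREW BLINDNESS LAW below `M ≤ 512`

Folder/HOME-only (0 registry verbs · 0 routes · 0 sorry).  COMMON OBJECT = rh-idea-2's planted pair
(`RhIdea2G21.W06C6.pairDefect / plantedScrew / plantedScrewMatrix`, copied VERBATIM from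
`pub/ideators/rh-idea-2/g21/c26/Sketch-C2c6-v2.lean` sha16 bbf764651e6c1e8c, l.23–35): the zero multiset of `ζ`
plus ONE planted off-line quadruple `{1/2 ± δ ± iγ}`; `plantedScrewMatrix δ γ n = S_{n+1}(ζ) + D_{n+1}(δ, γ)` on the
integer nodes `log 2, …, log (n+1)`.

BLINDNESS LAW (kernel, this file): with the TREE MARGIN `μ₅₁₂ = 154108636812/2^49 ≤ λ_min(S_512)`
(`IntegerScrew.screwMatrix_quadForm_ge_511`, `Theorems/IntegerScrewRung512.lean:83`) restricted to every leading
block (`screwMatrix_quadForm_ge_of_le`, the `_of_le_127` pattern of `IntegerScrewRung128.lean:352` made generic), the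
entrywise bound `|D i j| ≤ 12·((n+1)^δ + 1)/(δ² + γ²)` and the ℓ¹/Cauchy–Schwarz perturbation step
`|xᵀ D x| ≤ n·ε·‖x‖²`:

* `plantedScrewMatrix_posDef_of_margin` — for ANY certified margin `μ` of `S_{N+1}` and `n ≤ N`:
  `n · 12·((n+1)^δ + 1) < μ·(δ² + γ²) ⟹ plantedScrewMatrix δ γ n ≻ 0`;
* `plantedScrewMatrix_posDef_of_bound_511 / _255 / _127` — the tree's margins `μ₅₁₂, μ₂₅₆, μ₁₂₈`
  (`IntegerScrewRung512/256/128`), every `n ≤ 511 / 255 / 127`;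
* `plantedScrewMatrix_posDef_of_corner` + `_of_le_511 / _of_le_255 / _of_le_127` — explicit corners:
  `0 ≤ δ ≤ 1/2` and `γ ≥ 23010 / 7760 / 3180 ⟹ S_M(planted) ≻ 0` for all `M ≤ 512 / 256 / 128`
  (sharp thresholds of THIS bound `b_S = 23005.7 / 7754.9 / 3175.99`);
* `not_screwSees_of_le_512` — the same in rh-idea-2's `ScrewSeesPairBy` words.

LAW (closed form): `b_S(n, δ; μ) = √(12·n·((n+1)^δ + 1)/μ − δ²)`, `μ = μ(bank of n)`; numbers (δ = 0 / 0.25 / 0.5):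
`M = 512: 6693 / 11356 / 23005`, `256: 2660 / 4206 / 7755`, `128: 1280 / 1891 / 3176`, `64: 901 / 1247 / 1912`,
`32: 632 / 822 / 1154` (tiers `μ₁₂₈` for `n ≤ 127`, `μ₂₅₆` for `n ≤ 255`, `μ₅₁₂` for `n ≤ 511`).  The factor `n`
is the crude ℓ¹ step (`‖D‖_op ≤ n·max|D i j|`); the true reach (C2⁶ numerics `M₀ ≈ 0.1·γ^{1.3}·δ^{−1.7}`) is far lower.

READING (TEST 0): the planted object is NOT `ζ`; «`S_M(planted) ≻ 0` for `M ≤ 512`» says the integer-node screw test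
of order ≤ 512 is BLIND to a quadruple planted above height `b_S(n, δ)`; neither direction is RH-strength and nothing
here bears on the truth of RH.  The tree's `S_512(ζ) ≻ 0` is an RH-consequence made unconditional by computation.
-/

noncomputable section


namespace RhIdea6.G15.C47

open Matrix
open Literature.NumberTheory.LFunctions
open RhIdea2G21.W06C6
open Summit.RiemannHypothesis.RiemannHypothesis.Theorems.IntegerScrew

/-! ### §1  The planted matrix = tree screw matrix + defect matrix -/

/-- The defect KERNEL `D(t, u) = Q(t) + Q(u) − Q(t − u)` of the planted quadruple. -/
def defectKernel (δ γ t u : ℝ) : ℝ :=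
  pairDefect δ γ t + pairDefect δ γ u - pairDefect δ γ (t - u)

/-- The defect MATRIX `D_{n+1}(δ, γ) = [D(log(i+2), log(j+2))]_{i,j<n}`. -/
def defectMatrix (δ γ : ℝ) (n : ℕ) : Matrix (Fin n) (Fin n) ℝ :=
  Matrix.of fun i j => defectKernel δ γ (Real.log (((i : ℕ) : ℝ) + 2)) (Real.log (((j : ℕ) : ℝ) + 2))

/-- The pair defect `Q` is even in `t`: `Q(−t) = Q(t)`. -/
theorem pairDefect_neg (δ γ t : ℝ) : pairDefect δ γ (-t) = pairDefect δ γ t := by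
  simp only [pairDefect, abs_neg]

/-- The planted screw function is even in `t` (from `pairDefect_neg` and `zetaScrew_neg`). -/
theorem plantedScrew_neg (δ γ t : ℝ) : plantedScrew δ γ (-t) = plantedScrew δ γ t := by
  simp only [plantedScrew, pairDefect_neg, zetaScrew_neg]

/-- `S_{n+1}(planted) = S_{n+1}(ζ) + D_{n+1}(δ, γ)` entrywise. -/
theorem plantedScrewMatrix_eq (δ γ : ℝ) (n : ℕ) :
    plantedScrewMatrix δ γ n = screwMatrix n + defectMatrix δ γ n := by
  ext i j
  simp only [plantedScrewMatrix, defectMatrix, defectKernel, plantedScrew, Matrix.of_apply,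
    Matrix.add_apply, screwMatrix_apply, zetaScrewKernel_def, Nat.cast_add, Nat.cast_ofNat]
  ring

/-- The planted screw matrix is real symmetric. -/
theorem plantedScrewMatrix_isHermitian (δ γ : ℝ) (n : ℕ) : (plantedScrewMatrix δ γ n).IsHermitian :=
  Matrix.IsHermitian.ext fun i j => by
    simp only [star_trivial, plantedScrewMatrix, Matrix.of_apply]
    rw [show Real.log (((j : ℕ) : ℝ) + 2) - Real.log (((i : ℕ) : ℝ) + 2)
        = -(Real.log (((i : ℕ) : ℝ) + 2) - Real.log (((j : ℕ) : ℝ) + 2)) by ring, plantedScrew_neg]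
    ring

/-! ### §2  Generic perturbation step: margin `μ` + entrywise `ε` + `n·ε < μ` ⟹ `S + D ≻ 0` -/

/-- ℓ¹/Cauchy–Schwarz: `|xᵀ D x| ≤ n·ε·‖x‖²` when every `|D i j| ≤ ε`. -/
theorem abs_dotProduct_mulVec_le {n : ℕ} (D : Matrix (Fin n) (Fin n) ℝ) {ε : ℝ} (hε0 : 0 ≤ ε)
    (hε : ∀ i j, |D i j| ≤ ε) (x : Fin n → ℝ) :
    |x ⬝ᵥ (D *ᵥ x)| ≤ (n : ℝ) * ε * (x ⬝ᵥ x) := by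
  have hexp : x ⬝ᵥ (D *ᵥ x) = ∑ i, ∑ j, x i * (D i j * x j) := by
    simp only [dotProduct, Matrix.mulVec, Finset.mul_sum]
  have h1 : |x ⬝ᵥ (D *ᵥ x)| ≤ ε * (∑ i, |x i|) ^ 2 := by
    rw [hexp]
    calc |∑ i, ∑ j, x i * (D i j * x j)|
        ≤ ∑ i, |∑ j, x i * (D i j * x j)| := Finset.abs_sum_le_sum_abs _ _
      _ ≤ ∑ i, ∑ j, |x i| * (ε * |x j|) := by
          refine Finset.sum_le_sum fun i _ =>
            (Finset.abs_sum_le_sum_abs _ _).trans (Finset.sum_le_sum fun j _ => ?_)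
          rw [abs_mul, abs_mul]
          exact mul_le_mul_of_nonneg_left (mul_le_mul_of_nonneg_right (hε i j) (abs_nonneg _))
            (abs_nonneg _)
      _ = ε * (∑ i, |x i|) ^ 2 := by
          rw [sq, Finset.sum_mul_sum, Finset.mul_sum]
          refine Finset.sum_congr rfl fun i _ => ?_
          rw [Finset.mul_sum]
          refine Finset.sum_congr rfl fun j _ => ?_
          ring
  have h2 : (∑ i, |x i|) ^ 2 ≤ (n : ℝ) * (x ⬝ᵥ x) := by
    have hcs := Finset.sum_mul_sq_le_sq_mul_sq Finset.univ (fun i => |x i|) (fun _ => (1 : ℝ))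
    have e1 : (∑ i : Fin n, |x i| * 1) = ∑ i, |x i| := by simp
    have e2 : (∑ i : Fin n, |x i| ^ 2) = x ⬝ᵥ x := by simp [dotProduct, sq]
    have e3 : (∑ _i : Fin n, (1 : ℝ) ^ 2) = n := by simp
    rw [e1, e2, e3] at hcs
    linarith
  calc |x ⬝ᵥ (D *ᵥ x)| ≤ ε * (∑ i, |x i|) ^ 2 := h1
    _ ≤ ε * ((n : ℝ) * (x ⬝ᵥ x)) := mul_le_mul_of_nonneg_left h2 hε0
    _ = (n : ℝ) * ε * (x ⬝ᵥ x) := by ring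

/-- PERTURBATION STEP: `μ‖v‖² ≤ vᵀSv` for all `v`, `|D i j| ≤ ε`, `n·ε < μ`, `S + D` symmetric ⟹ `S + D ≻ 0`. -/
theorem posDef_add_of_quadForm_ge {n : ℕ} {S D : Matrix (Fin n) (Fin n) ℝ} {μ ε : ℝ}
    (hH : (S + D).IsHermitian)
    (hμ : ∀ v : Fin n → ℝ, μ * (v ⬝ᵥ v) ≤ v ⬝ᵥ (S *ᵥ v))
    (hε0 : 0 ≤ ε) (hε : ∀ i j, |D i j| ≤ ε) (hnε : (n : ℝ) * ε < μ) :
    (S + D).PosDef := by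
  refine Matrix.PosDef.of_dotProduct_mulVec_pos hH fun x hx => ?_
  have hxx : 0 < x ⬝ᵥ x := by
    obtain ⟨i, hi⟩ := Function.ne_iff.mp hx
    calc (0 : ℝ) < x i * x i := mul_self_pos.mpr hi
      _ ≤ x ⬝ᵥ x :=
          Finset.single_le_sum (f := fun j => x j * x j) (fun j _ => mul_self_nonneg (x j))
            (Finset.mem_univ i)
  have hD := (abs_le.mp (abs_dotProduct_mulVec_le D hε0 hε x)).1
  have hS := hμ x
  have hlt := mul_lt_mul_of_pos_right hnε hxx
  rw [star_trivial, Matrix.add_mulVec, dotProduct_add]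
  nlinarith

/-! ### §3  The tree margin on every leading block (`_of_le_127` pattern of `IntegerScrewRung128`, generic) -/

/-- A certified margin `μ‖v‖² ≤ vᵀ S_{N+1} v` descends to every leading block `S_{n+1}`, `n ≤ N`
(a principal submatrix of `S_{N+1} − μI ⪰ 0` is `⪰ 0`). -/
theorem screwMatrix_quadForm_ge_of_le {N n : ℕ} (hn : n ≤ N) {μ : ℝ}
    (hN : ∀ v : Fin N → ℝ, μ * (v ⬝ᵥ v) ≤ v ⬝ᵥ ((screwMatrix N).mulVec v)) (v : Fin n → ℝ) :
    μ * (v ⬝ᵥ v) ≤ v ⬝ᵥ ((screwMatrix n).mulVec v) := by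
  have hH : (screwMatrix N - μ • (1 : Matrix (Fin N) (Fin N) ℝ)).IsHermitian :=
    (screwMatrix_isHermitian N).sub (Matrix.isHermitian_one.smul (IsSelfAdjoint.all _))
  have h1 : (screwMatrix N - μ • (1 : Matrix (Fin N) (Fin N) ℝ)).PosSemidef := by
    refine Matrix.PosSemidef.of_dotProduct_mulVec_nonneg hH fun x => ?_
    have hx := hN x
    rw [star_trivial, Matrix.sub_mulVec, dotProduct_sub, Matrix.smul_mulVec, Matrix.one_mulVec,
      dotProduct_smul, smul_eq_mul]
    linarith
  have h3 : (screwMatrix N - μ • (1 : Matrix (Fin N) (Fin N) ℝ)).submatrix (Fin.castLE hn) (Fin.castLE hn)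
      = screwMatrix n - μ • (1 : Matrix (Fin n) (Fin n) ℝ) := by
    rw [show (screwMatrix N - μ • (1 : Matrix (Fin N) (Fin N) ℝ)).submatrix (Fin.castLE hn) (Fin.castLE hn)
        = (screwMatrix N).submatrix (Fin.castLE hn) (Fin.castLE hn) -
          μ • (1 : Matrix (Fin N) (Fin N) ℝ).submatrix (Fin.castLE hn) (Fin.castLE hn) from rfl,
      screwMatrix_submatrix_castLE hn, Matrix.submatrix_one _ (Fin.castLE_injective hn)]
  have h2 := (h1.submatrix (Fin.castLE hn)).dotProduct_mulVec_nonneg v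
  rw [h3, star_trivial, Matrix.sub_mulVec, dotProduct_sub, Matrix.smul_mulVec, Matrix.one_mulVec,
    dotProduct_smul, smul_eq_mul] at h2
  linarith

/-- MARGIN LEMMA USED (tree): `μ₅₁₂ = 154108636812/2^49 ≤ λ_min(S_{n+1})` for every `n ≤ 511`, from
`IntegerScrew.screwMatrix_quadForm_ge_511`. -/
theorem screwMatrix_quadForm_ge_of_le_511 {n : ℕ} (hn : n ≤ 511) (v : Fin n → ℝ) :
    (154108636812 : ℝ) / 2 ^ 49 * (v ⬝ᵥ v) ≤ v ⬝ᵥ ((screwMatrix n).mulVec v) :=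
  screwMatrix_quadForm_ge_of_le hn screwMatrix_quadForm_ge_511 v

/-! ### §4  Entrywise size of the defect -/

/-- One zero-side increment: `|Re[(e^{w|t|} − 1)/w²]| ≤ (e^{a|t|} + 1)/(a² + γ²)`, `w = a + iγ`, `γ ≠ 0`. -/
theorem abs_re_increment_le (a γ t : ℝ) (hγ : γ ≠ 0) :
    |((Complex.exp ((⟨a, γ⟩ : ℂ) * (|t| : ℝ)) - 1) / ((⟨a, γ⟩ : ℂ) ^ 2)).re|
      ≤ (Real.exp (a * |t|) + 1) / (a ^ 2 + γ ^ 2) := by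
  have hw : ‖((⟨a, γ⟩ : ℂ) ^ 2)‖ = a ^ 2 + γ ^ 2 := by
    rw [norm_pow, Complex.sq_norm, Complex.normSq_mk]; ring
  have hre : ((⟨a, γ⟩ : ℂ) * (|t| : ℝ)).re = a * |t| := by
    simp [Complex.mul_re]
  have hd : 0 < a ^ 2 + γ ^ 2 := by positivity
  calc |((Complex.exp ((⟨a, γ⟩ : ℂ) * (|t| : ℝ)) - 1) / ((⟨a, γ⟩ : ℂ) ^ 2)).re|
      ≤ ‖(Complex.exp ((⟨a, γ⟩ : ℂ) * (|t| : ℝ)) - 1) / ((⟨a, γ⟩ : ℂ) ^ 2)‖ := Complex.abs_re_le_norm _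
    _ = ‖Complex.exp ((⟨a, γ⟩ : ℂ) * (|t| : ℝ)) - 1‖ / (a ^ 2 + γ ^ 2) := by rw [norm_div, hw]
    _ ≤ (Real.exp (a * |t|) + 1) / (a ^ 2 + γ ^ 2) := by
        refine div_le_div_of_nonneg_right ?_ hd.le
        calc ‖Complex.exp ((⟨a, γ⟩ : ℂ) * (|t| : ℝ)) - 1‖
            ≤ ‖Complex.exp ((⟨a, γ⟩ : ℂ) * (|t| : ℝ))‖ + ‖(1 : ℂ)‖ := norm_sub_le _ _
          _ = Real.exp (a * |t|) + 1 := by rw [Complex.norm_exp, norm_one, hre]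

/-- `|Q(t; δ, γ)| ≤ 4·(e^{δ|t|} + 1)/(δ² + γ²)` for `δ ≥ 0`, `γ ≠ 0`. -/
theorem abs_pairDefect_le {δ γ : ℝ} (hδ : 0 ≤ δ) (hγ : γ ≠ 0) (t : ℝ) :
    |pairDefect δ γ t| ≤ 4 * ((Real.exp (δ * |t|) + 1) / (δ ^ 2 + γ ^ 2)) := by
  have h1 := abs_re_increment_le δ γ t hγ
  have h2 := abs_re_increment_le (-δ) γ t hγ
  rw [neg_sq] at h2
  have hd : 0 < δ ^ 2 + γ ^ 2 := by positivity
  have h3 : Real.exp (-δ * |t|) ≤ Real.exp (δ * |t|) :=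
    Real.exp_le_exp.mpr (by nlinarith [abs_nonneg t])
  have h4 : (Real.exp (-δ * |t|) + 1) / (δ ^ 2 + γ ^ 2) ≤ (Real.exp (δ * |t|) + 1) / (δ ^ 2 + γ ^ 2) :=
    div_le_div_of_nonneg_right (by linarith) hd.le
  unfold pairDefect
  refine (abs_add_le _ _).trans ?_
  rw [abs_mul, abs_mul, abs_two]
  linarith [h2.trans h4]

/-- Monotone envelope: `|t| ≤ L ⟹ |Q(t)| ≤ 4·(e^{δL} + 1)/(δ² + γ²)`. -/
theorem abs_pairDefect_le_of_abs_le {δ γ L t : ℝ} (hδ : 0 ≤ δ) (hγ : γ ≠ 0) (ht : |t| ≤ L) :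
    |pairDefect δ γ t| ≤ 4 * ((Real.exp (δ * L) + 1) / (δ ^ 2 + γ ^ 2)) := by
  refine (abs_pairDefect_le hδ hγ t).trans ?_
  have hd : 0 < δ ^ 2 + γ ^ 2 := by positivity
  have h1 : Real.exp (δ * |t|) ≤ Real.exp (δ * L) := Real.exp_le_exp.mpr (mul_le_mul_of_nonneg_left ht hδ)
  have h2 : (Real.exp (δ * |t|) + 1) / (δ ^ 2 + γ ^ 2) ≤ (Real.exp (δ * L) + 1) / (δ ^ 2 + γ ^ 2) :=
    div_le_div_of_nonneg_right (by linarith) hd.le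
  linarith

/-- The nodes: `0 ≤ log(i+2) ≤ log(n+1)` for `i < n`. -/
theorem log_node_mem {n : ℕ} (i : Fin n) :
    0 ≤ Real.log (((i : ℕ) : ℝ) + 2) ∧ Real.log (((i : ℕ) : ℝ) + 2) ≤ Real.log ((n : ℝ) + 1) := by
  have h0 : (0 : ℝ) ≤ ((i : ℕ) : ℝ) := Nat.cast_nonneg _
  have hi : ((i : ℕ) : ℝ) + 1 ≤ (n : ℝ) := by exact_mod_cast Nat.succ_le_of_lt i.isLt
  exact ⟨Real.log_nonneg (by linarith), Real.log_le_log (by linarith) (by linarith)⟩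

/-- ENTRYWISE DEFECT BOUND: `|D_{n+1}(δ, γ) i j| ≤ 12·(e^{δ·log(n+1)} + 1)/(δ² + γ²) = 12·((n+1)^δ + 1)/(δ² + γ²)`. -/
theorem abs_defectMatrix_le {δ γ : ℝ} (hδ : 0 ≤ δ) (hγ : γ ≠ 0) (n : ℕ) (i j : Fin n) :
    |defectMatrix δ γ n i j| ≤ 12 * ((Real.exp (δ * Real.log ((n : ℝ) + 1)) + 1) / (δ ^ 2 + γ ^ 2)) := by
  obtain ⟨hi0, hi⟩ := log_node_mem i
  obtain ⟨hj0, hj⟩ := log_node_mem j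
  have h1 := abs_pairDefect_le_of_abs_le hδ hγ (t := Real.log (((i : ℕ) : ℝ) + 2))
    (L := Real.log ((n : ℝ) + 1)) (by rw [abs_of_nonneg hi0]; exact hi)
  have h2 := abs_pairDefect_le_of_abs_le hδ hγ (t := Real.log (((j : ℕ) : ℝ) + 2))
    (L := Real.log ((n : ℝ) + 1)) (by rw [abs_of_nonneg hj0]; exact hj)
  have h3 := abs_pairDefect_le_of_abs_le hδ hγ
    (t := Real.log (((i : ℕ) : ℝ) + 2) - Real.log (((j : ℕ) : ℝ) + 2))
    (L := Real.log ((n : ℝ) + 1)) (abs_sub_le_iff.mpr ⟨by linarith, by linarith⟩)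
  simp only [defectMatrix, defectKernel, Matrix.of_apply]
  have h4 := abs_add_le (pairDefect δ γ (Real.log (((i : ℕ) : ℝ) + 2)))
    (pairDefect δ γ (Real.log (((j : ℕ) : ℝ) + 2)))
  have h5 := abs_sub (pairDefect δ γ (Real.log (((i : ℕ) : ℝ) + 2)) + pairDefect δ γ (Real.log (((j : ℕ) : ℝ) + 2)))
    (pairDefect δ γ (Real.log (((i : ℕ) : ℝ) + 2) - Real.log (((j : ℕ) : ℝ) + 2)))
  linarith

/-! ### §5  The blindness law -/

/-- **SCREW BLINDNESS LAW (generic margin).**  If `μ‖v‖² ≤ vᵀ S_{N+1}(ζ) v` is certified and `n ≤ N`, then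
`n · 12·(e^{δ log(n+1)} + 1) < μ·(δ² + γ²) ⟹ S_{n+1}(planted δ, γ) ≻ 0`: the order-`(n+1)` integer-node screw
test does not see a quadruple planted at height `γ ≥ b_S(n, δ; μ) = √(12 n ((n+1)^δ + 1)/μ − δ²)`. -/
theorem plantedScrewMatrix_posDef_of_margin {N n : ℕ} {μ δ γ : ℝ} (hn : n ≤ N)
    (hN : ∀ v : Fin N → ℝ, μ * (v ⬝ᵥ v) ≤ v ⬝ᵥ ((screwMatrix N).mulVec v))
    (hδ : 0 ≤ δ) (hγ : γ ≠ 0)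
    (h : (n : ℝ) * (12 * ((Real.exp (δ * Real.log ((n : ℝ) + 1)) + 1) / (δ ^ 2 + γ ^ 2))) < μ) :
    (plantedScrewMatrix δ γ n).PosDef := by
  have hH := plantedScrewMatrix_isHermitian δ γ n
  rw [plantedScrewMatrix_eq] at hH ⊢
  exact posDef_add_of_quadForm_ge hH (screwMatrix_quadForm_ge_of_le hn hN) (by positivity)
    (abs_defectMatrix_le hδ hγ n) h

/-- **SCREW BLINDNESS LAW at the tree margin `μ₅₁₂ = 154108636812/2^49`** (every `M = n+1 ≤ 512`;
margin lemma `IntegerScrew.screwMatrix_quadForm_ge_511`, `Theorems/IntegerScrewRung512.lean:83`). -/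
theorem plantedScrewMatrix_posDef_of_bound_511 {n : ℕ} {δ γ : ℝ} (hn : n ≤ 511) (hδ : 0 ≤ δ) (hγ : γ ≠ 0)
    (h : (n : ℝ) * (12 * ((Real.exp (δ * Real.log ((n : ℝ) + 1)) + 1) / (δ ^ 2 + γ ^ 2)))
      < (154108636812 : ℝ) / 2 ^ 49) :
    (plantedScrewMatrix δ γ n).PosDef :=
  plantedScrewMatrix_posDef_of_margin hn screwMatrix_quadForm_ge_511 hδ hγ h

/-- The same law at the sharper tree margins of the lower banks: `μ₂₅₆ = 486953506312/2^49` (`M ≤ 256`,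
`IntegerScrew.screwMatrix_quadForm_ge_255`, `Theorems/IntegerScrewRung256.lean:123`). -/
theorem plantedScrewMatrix_posDef_of_bound_255 {n : ℕ} {δ γ : ℝ} (hn : n ≤ 255) (hδ : 0 ≤ δ) (hγ : γ ≠ 0)
    (h : (n : ℝ) * (12 * ((Real.exp (δ * Real.log ((n : ℝ) + 1)) + 1) / (δ ^ 2 + γ ^ 2)))
      < (486953506312 : ℝ) / 2 ^ 49) :
    (plantedScrewMatrix δ γ n).PosDef :=
  plantedScrewMatrix_posDef_of_margin hn screwMatrix_quadForm_ge_255 hδ hγ h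

/-- … and `μ₁₂₈ = 1047359042446/2^49` (`M ≤ 128`, `IntegerScrew.screwMatrix_quadForm_ge_127`,
`Theorems/IntegerScrewRung128.lean:343`). -/
theorem plantedScrewMatrix_posDef_of_bound_127 {n : ℕ} {δ γ : ℝ} (hn : n ≤ 127) (hδ : 0 ≤ δ) (hγ : γ ≠ 0)
    (h : (n : ℝ) * (12 * ((Real.exp (δ * Real.log ((n : ℝ) + 1)) + 1) / (δ ^ 2 + γ ^ 2)))
      < (1047359042446 : ℝ) / 2 ^ 49) :
    (plantedScrewMatrix δ γ n).PosDef :=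
  plantedScrewMatrix_posDef_of_margin hn screwMatrix_quadForm_ge_127 hδ hγ h

/-! ### §6  Explicit corners (numbers) -/

/-- `(n+1)^δ ≤ B` whenever `n + 1 ≤ K ≤ B²`, `0 ≤ B`, `δ ≤ 1/2` (used with `(K, B) = (512, 22.628), (256, 16), (128, 11.314)`). -/
theorem exp_mul_log_le {n K : ℕ} {δ B : ℝ} (hK : n + 1 ≤ K) (hδ' : δ ≤ 1 / 2) (hB : 0 ≤ B)
    (hKB : (K : ℝ) ≤ B * B) : Real.exp (δ * Real.log ((n : ℝ) + 1)) ≤ B := by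
  have hn0 : (0 : ℝ) ≤ n := Nat.cast_nonneg n
  have hK' : (n : ℝ) + 1 ≤ K := by exact_mod_cast hK
  have hKpos : (0 : ℝ) < K := by linarith
  have hL0 : 0 ≤ Real.log ((n : ℝ) + 1) := Real.log_nonneg (by linarith)
  have hL : Real.log ((n : ℝ) + 1) ≤ Real.log K := Real.log_le_log (by linarith) hK'
  have hδL : δ * Real.log ((n : ℝ) + 1) ≤ 1 / 2 * Real.log K := mul_le_mul hδ' hL hL0 (by norm_num)
  have hE : Real.exp (δ * Real.log ((n : ℝ) + 1)) ≤ Real.exp (1 / 2 * Real.log K) := Real.exp_le_exp.mpr hδL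
  have hsq : Real.exp (1 / 2 * Real.log K) * Real.exp (1 / 2 * Real.log K) = K := by
    rw [← Real.exp_add, show (1 / 2 : ℝ) * Real.log K + 1 / 2 * Real.log K = Real.log K by ring,
      Real.exp_log hKpos]
  have hS : Real.exp (1 / 2 * Real.log K) ≤ B := by
    by_contra hc
    rw [not_le] at hc
    have := mul_self_lt_mul_self hB hc
    linarith
  linarith

/-- **EXPLICIT CORNER, generic**: margin `μ ≥ 0` for `S_{N+1}`, `n ≤ N`, `(n+1)^δ ≤ B`, `0 < g₀ ≤ γ` and the ONE
numerical inequality `N·12·(B + 1) < μ·g₀²` give `S_{n+1}(planted δ, γ) ≻ 0`. -/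
theorem plantedScrewMatrix_posDef_of_corner {N n : ℕ} {μ δ γ B g₀ : ℝ} (hn : n ≤ N)
    (hN : ∀ v : Fin N → ℝ, μ * (v ⬝ᵥ v) ≤ v ⬝ᵥ ((screwMatrix N).mulVec v)) (hμ : 0 ≤ μ)
    (hδ : 0 ≤ δ) (hE : Real.exp (δ * Real.log ((n : ℝ) + 1)) ≤ B) (hg₀ : 0 < g₀) (hγ : g₀ ≤ γ)
    (hnum : (N : ℝ) * (12 * (B + 1)) < μ * (g₀ * g₀)) :
    (plantedScrewMatrix δ γ n).PosDef := by
  have hγ0 : γ ≠ 0 := (hg₀.trans_le hγ).ne'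
  refine plantedScrewMatrix_posDef_of_margin hn hN hδ hγ0 ?_
  have hEpos := Real.exp_pos (δ * Real.log ((n : ℝ) + 1))
  have hB1 : 0 ≤ B + 1 := by linarith
  have hd : 0 < δ ^ 2 + γ ^ 2 := by positivity
  have hn' : (n : ℝ) ≤ N := by exact_mod_cast hn
  have hn0 : (0 : ℝ) ≤ n := Nat.cast_nonneg n
  have hγ2 : g₀ * g₀ ≤ γ * γ := mul_le_mul hγ hγ hg₀.le (hg₀.le.trans hγ)
  rw [show (n : ℝ) * (12 * ((Real.exp (δ * Real.log ((n : ℝ) + 1)) + 1) / (δ ^ 2 + γ ^ 2)))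
      = (n : ℝ) * (12 * (Real.exp (δ * Real.log ((n : ℝ) + 1)) + 1)) / (δ ^ 2 + γ ^ 2) by ring,
    div_lt_iff₀ hd]
  nlinarith [mul_nonneg hn0 (sub_nonneg.mpr hE), mul_nonneg (sub_nonneg.mpr hn') hB1,
    mul_le_mul_of_nonneg_left hγ2 hμ, mul_nonneg hμ (sq_nonneg δ)]

/-- **EXPLICIT CORNER `M ≤ 512`** (the cell's law with numbers): for `0 ≤ δ ≤ 1/2` and `γ ≥ 23010` EVERY planted
screw matrix of order `≤ 512` is positive definite — the integer-node screw test below the tree's bank is blind to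
one off-line quadruple planted that high (`511·12·(22.628 + 1) = 144886.9 < μ₅₁₂·23010² = 144940.7`; sharp
threshold of this bound `23005.7…`). -/
theorem plantedScrewMatrix_posDef_of_le_511 {n : ℕ} {δ γ : ℝ} (hn : n ≤ 511) (hδ : 0 ≤ δ) (hδ' : δ ≤ 1 / 2)
    (hγ : 23010 ≤ γ) : (plantedScrewMatrix δ γ n).PosDef :=
  plantedScrewMatrix_posDef_of_corner hn screwMatrix_quadForm_ge_511 (by norm_num) hδ
    (exp_mul_log_le (K := 512) (B := 22628 / 1000) (by omega) hδ' (by norm_num) (by norm_num))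
    (by norm_num) hγ (by norm_num)

/-- **EXPLICIT CORNER `M ≤ 256`**: `0 ≤ δ ≤ 1/2`, `γ ≥ 7760` (`255·12·17 = 52020 < μ₂₅₆·7760² = 52088.4`;
sharp threshold `7754.9…`). -/
theorem plantedScrewMatrix_posDef_of_le_255 {n : ℕ} {δ γ : ℝ} (hn : n ≤ 255) (hδ : 0 ≤ δ) (hδ' : δ ≤ 1 / 2)
    (hγ : 7760 ≤ γ) : (plantedScrewMatrix δ γ n).PosDef :=
  plantedScrewMatrix_posDef_of_corner hn screwMatrix_quadForm_ge_255 (by norm_num) hδ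
    (exp_mul_log_le (K := 256) (B := 16) (by omega) hδ' (by norm_num) (by norm_num))
    (by norm_num) hγ (by norm_num)

/-- **EXPLICIT CORNER `M ≤ 128`**: `0 ≤ δ ≤ 1/2`, `γ ≥ 3180` (`127·12·12.314 = 18766.5 < μ₁₂₈·3180² = 18813.9`;
sharp threshold `3175.99…`). -/
theorem plantedScrewMatrix_posDef_of_le_127 {n : ℕ} {δ γ : ℝ} (hn : n ≤ 127) (hδ : 0 ≤ δ) (hδ' : δ ≤ 1 / 2)
    (hγ : 3180 ≤ γ) : (plantedScrewMatrix δ γ n).PosDef :=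
  plantedScrewMatrix_posDef_of_corner hn screwMatrix_quadForm_ge_127 (by norm_num) hδ
    (exp_mul_log_le (K := 128) (B := 11314 / 1000) (by omega) hδ' (by norm_num) (by norm_num))
    (by norm_num) hγ (by norm_num)

/-- The `M ≤ 512` corner phrased as «NOT seen by order `M ≤ 512`» in rh-idea-2's vocabulary
(`ScrewSeesPairBy δ γ M := ∃ n, n + 1 ≤ M ∧ ¬ (plantedScrewMatrix δ γ n).PosSemidef`, Sketch-C2c6-v2 l.38). -/
theorem not_screwSees_of_le_512 {δ γ : ℝ} (hδ : 0 ≤ δ) (hδ' : δ ≤ 1 / 2) (hγ : 23010 ≤ γ) {M : ℕ} (hM : M ≤ 512) :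
    ¬ ∃ n : ℕ, n + 1 ≤ M ∧ ¬ (plantedScrewMatrix δ γ n).PosSemidef := by
  rintro ⟨n, hnM, hnot⟩
  exact hnot (plantedScrewMatrix_posDef_of_le_511 (by omega) hδ hδ' hγ).posSemidef

end RhIdea6.G15.C47

end
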